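import Mathlib
import HarnessLib
import Literature.Analysis.FluidPDE.OkamotoSakajoWunsch2008.QuantisedFamily

/-!
# Okamoto–Sakajo–Wunsch separable blow-up: the a-priori location `1/p < a < 1` of every quantised parameter —
# the arithmetic step, kernel-checked

HONEST FRAMING (cell pub-oswblow, carried verbatim by every artefact of the cell):
**1-D model (gCLM/OSW), computer-assisted; not Euler/NS.**

Context. The OSW/gCLM equation `ω_t + a v ω_x = v_x ω`, `v_x = Hω` on the circle [cite: OkamotoSakajoWunsch2008, eq. (3)]
has exactly self-similar solutions `ω = f(x)/(T − t)` iff `f` solves the profile equation (T1) `f = −a g f′ + f·Hf`,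
`g′ = Hf`, `g(0) = 0` (ansatz of [cite: LushnikovSilantyevSiegel2021, §11]; typed target `AnalyticSeparableProfile` of
`SeparableBlowup.lean`, certified rows in `QuantisedFamily.lean`, `CertificateFamily*.lean`). The cell's LAW.md §4
THEOREM E2 (pen-and-paper, elementary) says: if `f ∈ C¹(𝕋)` is odd, negative on `(0, π)`, with a zero of odd order
`m ≥ 1` at the origin (`x f′(x)/f(x) → m`; `m = 1` for a simple zero) and vanishing order `p > 0` at the antipode
(`y f′(π+y)/f(π+y) → p`), and solves (T1) pointwise on `(0, π)`, then, writing `H₀ := Hf(0)` and `Hπ := Hf(π)`,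

* (ANALYTIC STEP, not formalised here — it needs the periodic Hilbert transform as an operator, which this library
  deliberately avoids, see the design note of `SeparableBlowup.lean`): dividing (T1) by `f` and letting `x → 0⁺`,
  `x → π⁻` gives the two identities `(1 − a·m)·H₀ = 1`, `(1 − a·p)·Hπ = 1` (using `g(x)/x → H₀`, `g(π+y)/y → Hπ`,
  the latter because `g(π) = ½∫_{−π}^{π} Hf = 0`), and the kernel representation `H₀ = −(1/π)∫₀^π f(y) cot(y/2) dy`,
  `Hπ = (1/π)∫₀^π f(y) tan(y/2) dy` (multiplier `−i·sgn k`, cf. `hilbertSymbol_one_neg_one_zero`) gives the signs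
  `H₀ > 0 > Hπ` for `f < 0` on `(0, π)`;
* (ARITHMETIC STEP, this file): the identities and signs force `1/p < a < 1/m ≤ 1`.

So every rung of the quantised ladder satisfies `1/P < a*_P < 1` — the side condition that the cell's Newton–Kantorovich
frame (Lemma F) ASSUMES is in fact NECESSARY; and an exactly self-similar odd negative profile with a degenerate zero at
the origin (`m ≥ 3`) could only exist for `a < 1/3`. This is the only unconditional statement about ALL rungs the cell
has; it is far from the conjectured `a*_P > a_c ≈ 0.689` (LAW.md C2). The theorems below are plain real arithmetic
(no analysis, nothing about the OSW equation is asserted); they are recorded so that the paper's Proposition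
"a-priori location" has its final step kernel-checked, exactly as `blowup_of_analyticSeparableProfile` kernel-checks the
algebraic step of the blow-up corollary. The last lemma checks the statement against the certified `P = 3` window of
`QuantisedFamily.lean` (`1/3 < 0.755272287 ≤ a*₃ ≤ 0.755272288 < 1`), i.e. that the certified rung is consistent with E2.
-/

namespace Literature.Analysis.FluidPDE.OkamotoSakajoWunsch2008

namespace AprioriBounds

/-- Origin identity ⇒ upper bound: if `(1 − a·m)·H₀ = 1` with `H₀ > 0` and `m > 0` then `a < 1/m`.
(For a simple zero, `m = 1`, this is `a < 1`.) [folklore] -/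
theorem lt_inv_of_origin_identity {a m H0 : ℝ} (h0 : (1 - a * m) * H0 = 1) (hH0 : 0 < H0) (hm : 0 < m) :
    a < 1 / m := by
  have h1 : 0 < 1 - a * m := by nlinarith
  rw [lt_div_iff₀ hm]
  linarith

/-- Origin identity with a simple zero ⇒ `a < 1`. [folklore] -/
theorem lt_one_of_origin_identity {a H0 : ℝ} (h0 : (1 - a) * H0 = 1) (hH0 : 0 < H0) : a < 1 := by
  have h := lt_inv_of_origin_identity (a := a) (m := 1) (H0 := H0) (by simpa using h0) hH0 one_pos
  simpa using h

/-- Antipode identity ⇒ lower bound: if `(1 − a·p)·Hπ = 1` with `Hπ < 0` and `p > 0` then `1/p < a`. [folklore] -/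
theorem inv_lt_of_antipode_identity {a p Hpi : ℝ} (hpi : (1 - a * p) * Hpi = 1) (hHpi : Hpi < 0) (hp : 0 < p) :
    1 / p < a := by
  have h1 : 1 - a * p < 0 := by nlinarith
  rw [div_lt_iff₀ hp]
  linarith

/-- THEOREM E2, arithmetic step: the two identities and the two signs force `1/p < a < 1/m`. [folklore] -/
theorem apriori_window {a m p H0 Hpi : ℝ} (h0 : (1 - a * m) * H0 = 1) (hpi : (1 - a * p) * Hpi = 1)
    (hH0 : 0 < H0) (hHpi : Hpi < 0) (hm : 0 < m) (hp : 0 < p) : 1 / p < a ∧ a < 1 / m :=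
  ⟨inv_lt_of_antipode_identity hpi hHpi hp, lt_inv_of_origin_identity h0 hH0 hm⟩

/-- THEOREM E2 for a simple zero at the origin: `1/p < a < 1`; in particular `p > 1` — an exactly self-similar odd
negative `C¹` profile is automatically `C^{1,β}`-flat or better at the antipode only in the sense `p > 1/a > 1`. [folklore] -/
theorem apriori_bounds {a p H0 Hpi : ℝ} (h0 : (1 - a) * H0 = 1) (hpi : (1 - a * p) * Hpi = 1)
    (hH0 : 0 < H0) (hHpi : Hpi < 0) (hp : 0 < p) : 1 / p < a ∧ a < 1 ∧ 1 < p := by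
  have ha : a < 1 := lt_one_of_origin_identity h0 hH0
  have hlo : 1 / p < a := inv_lt_of_antipode_identity hpi hHpi hp
  refine ⟨hlo, ha, ?_⟩
  have : 1 / p < 1 := lt_trans hlo ha
  rwa [div_lt_one hp] at this

/-- The quantised case `p = P ∈ ℕ`: `1/P < a < 1`, hence `P ≥ 2` (and `P ≥ 3` when `P` is odd). [folklore] -/
theorem apriori_bounds_nat {a H0 Hpi : ℝ} {P : ℕ} (hP : 0 < P) (h0 : (1 - a) * H0 = 1)
    (hpi : (1 - a * (P : ℝ)) * Hpi = 1) (hH0 : 0 < H0) (hHpi : Hpi < 0) :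
    1 / (P : ℝ) < a ∧ a < 1 ∧ 2 ≤ P := by
  have hp : (0 : ℝ) < (P : ℝ) := by exact_mod_cast hP
  obtain ⟨hlo, ha, h1⟩ := apriori_bounds h0 hpi hH0 hHpi hp
  refine ⟨hlo, ha, ?_⟩
  have : (1 : ℝ) < (P : ℝ) := h1
  exact_mod_cast this

/-- The identities in the form the paper and the typed target use: `Hf(0) = 1/(1 − a)` and `Hf(π) = −1/(P a − 1)`
are the same as `(1 − a)·Hf(0) = 1`, `(1 − a P)·Hf(π) = 1` (denominators are then automatically non-zero). [folklore] -/
theorem identities_iff {a p H0 Hpi : ℝ} :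
    ((1 - a) * H0 = 1 ∧ (1 - a * p) * Hpi = 1) ↔
      (1 - a ≠ 0 ∧ H0 = 1 / (1 - a) ∧ p * a - 1 ≠ 0 ∧ Hpi = -1 / (p * a - 1)) := by
  constructor
  · rintro ⟨h0, hpi⟩
    have h1 : 1 - a ≠ 0 := by
      rintro h
      rw [h, zero_mul] at h0
      exact zero_ne_one h0
    have h2 : p * a - 1 ≠ 0 := by
      intro h
      have : 1 - a * p = 0 := by linarith
      rw [this, zero_mul] at hpi
      exact zero_ne_one hpi
    refine ⟨h1, ?_, h2, ?_⟩
    · field_simp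
      linarith
    · field_simp
      linarith
  · rintro ⟨h1, hH0, h2, hHpi⟩
    constructor
    · rw [hH0]
      field_simp
    · rw [hHpi, mul_div_assoc', div_eq_iff h2]
      ring

/-- The trichotomy exponent of the paper, `p(a) := (1 − 1/Hf(π))/a` (`a ≠ 0`, `Hf(π) ≠ 0`), is exactly the `p` of the
antipode identity. [folklore] -/
theorem antipode_identity_iff_p {a p Hpi : ℝ} (ha : a ≠ 0) (hH : Hpi ≠ 0) :
    (1 - a * p) * Hpi = 1 ↔ p = (1 - 1 / Hpi) / a := by
  constructor
  · intro h
    field_simp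
    have : Hpi - a * p * Hpi = 1 := by linarith [h]
    linarith
  · intro h
    rw [h]
    field_simp
    ring

/-- Consistency with the certified rung `P = 3`: the window of `QuantisedFamily.lean` lies inside E2's a-priori
interval `(1/3, 1)`. [folklore] -/
theorem window3_inside_apriori : (1 : ℝ) / 3 < 0.755272287 ∧ (0.755272288 : ℝ) < 1 := by
  constructor <;> norm_num

end AprioriBounds

end Literature.Analysis.FluidPDE.OkamotoSakajoWunsch2008
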